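import Literature.AlgebraicGeometry.ModuliOfAbelianVarieties.SiegelFamilyShimuraLocusEveryJ
import HarnessLib

/-!
# Shimura's Theorem 2, the Baire form: «`𝔜` cannot be covered by `∪_{f ∈ S′} X_f`» — the parameters of
# the sweep of `𝔜_j` whose torus has `End(X_Z) = ℤ` and no real structure are residual (comeagre) and
# dense (Shimura 1972, §3 Prop. 11 and Thm. 2)

Topic `Literature/AlgebraicGeometry/ModuliOfAbelianVarieties` (the Siegel-family files, namespace
`Literature.AlgebraicGeometry.ModuliOfAbelianVarieties.SiegelModuli`).  Lane `lit-hodgefound`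
(Track 2 foundations library), prover seat p15 generation 49, row g49-#2, on top of g49-#1
(`SiegelFamilyShimuraLocusEveryJ`: Thm. 2 at torus level at the point `Z(A + ᵗA, ᵗBB + 1)` of the sweep
of `𝔜_j` for EVERY integral `j` with `j² = −1`, `ᵗj = −j`, granted the `2g²` entries of `(A, B)` are
algebraically independent over `ℚ`) and g48-#6 (the sweep and the genericity transfer).  g48-#6/g49-#1
produce ONE generic point (from a transcendence basis of `ℝ/ℚ`); Shimura's proof says more: the
non-generic points `∪_{f ∈ S′} X_f` are a countable union of closed subsets with empty interior, so they
cannot cover `𝔜`.  THIS FILE proves that Baire-category statement in the tree's parameter rendering: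
the algebraically independent parameters form a dense `G_δ`, residual subset of `ℝ^{2g²}`, hence so do
the parameters whose torus has `End = ℤ`, is isomorphic to its conjugate and has no real structure.
THEOREMS ONLY: no definition, no instance, no notation, no named fact (net Literature debt `0`), no `sorry`.

## Source, VERBATIM

G. Shimura, *On the field of rationality for an abelian variety*, Nagoya Math. J. **45** (1972) 167–178,
held `paper:doi-10-1017-s0027763000014720`, §3, pp. 175–177:
«**PROPOSITION 11.** The set `𝔜` of Prop. 10 is non-empty.  Moreover, let `g` be a holomorphic function
defined on a connected domain `D` contained in `𝔖_n`.  If `g = 0` on a non-empty open subset of `D ∩ 𝔜`,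
then `g` is identically `0` on `D`. … Our second assertion follows from the following well-known facts:
(i) A holomorphic function `h(z)` in one complex variable `z` is identically `0`, if `h(x) = 0` for all
real `x`. (ii) A holomorphic function `h(z, z′)` in two complex variables `z` and `z′` is identically `0`,
if `h(z, z^ρ) = 0` for all complex `z`.»
«**THEOREM 2.** Let `P` be a generic polarized abelian variety of even dimension.  If the polarization
satisfies the condition (5), then `P` has no model rational over its field of moduli.  Proof. … Thus
`P_z` is generic if and only if `φ(z)` is generic on `V` over `ℚ`. … it is sufficient to find a generic
`P_z` with `z` in `𝔜`.  This can be done as follows.  Let `S` be the set of all homogeneous polynomials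
with rational coefficients viewed as functions in the projective space in which `V` is situated.  Let
`S′` be the subset of `S` consisting of all the `f ∈ S` such that `f ∘ φ` is not identically `0`.  Put,
for each `f ∈ S′`, `X_f = {z ∈ 𝔜 : f(φ(z)) = 0}`.  Then `X_f` is a closed subset of `𝔜`, which contains
no non-empty open subset of `𝔜` by Prop. 11.  Since `S′` is a countable set, `𝔜` cannot be covered by
`∪_{f ∈ S′} X_f`.  Therefore `𝔜` has a point `z` for which `f(φ(z)) ≠ 0` for all `f ∈ S′`.  Then `φ(z)`
is generic on `V` over `ℚ`, q.e.d.»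

## The tree's rendering

As in g48-#6/g49-#1, Shimura's «generic» (generic point of the moduli variety `V/ℚ`, via the holomorphic
`φ`) is replaced by the concrete sufficient condition «the `2g²` real coordinates `v = (A, B)` of the point
`Z(A + ᵗA, ᵗBB + 1)` of the sweep of `𝔜_j` are algebraically independent over `ℚ`»; accordingly
Shimura's `X_f` (`f` rational homogeneous, `f ∘ φ ≢ 0`) become the real zero sets
`X_p = {v : aeval v p = 0}` of the non-zero `p ∈ ℚ[x_1, …, x_{2g²}]`, and Prop. 11's «contains no
non-empty open subset» becomes §1.

* **§1 «`X_f` is a closed subset which contains no non-empty open subset».**  A real polynomial in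
  finitely many variables vanishing on a non-empty open subset of `ℝ^σ` is `0`
  (`mvPolynomial_eq_zero_of_eval_eq_zero_of_isOpen`: an open set contains a box with infinite sides,
  `MvPolynomial.funext_set`); so for `p ≠ 0` the set `{v : eval v p ≠ 0}` is open and dense
  (`isOpen_setOf_eval_ne_zero`, `dense_setOf_eval_ne_zero`), and the same for `ℚ`-coefficients and `aeval`
  (`dense_setOf_aeval_ne_zero`).
* **§2 «Since `S′` is a countable set, `𝔜` cannot be covered by `∪ X_f`».**
  `{v : AlgebraicIndependent ℚ v} = ⋂_{p ≠ 0} {v : aeval v p ≠ 0}` (`setOf_algebraicIndependent_eq_biInter`),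
  `ℚ[x_σ]` is countable (`countable_mvPolynomial_rat`), so by Baire the algebraically independent
  `v ∈ ℝ^σ` form a dense `G_δ`, residual set (`isGδ_setOf_algebraicIndependent`,
  `setOf_algebraicIndependent_mem_residual`, `dense_setOf_algebraicIndependent`; in particular every
  non-empty open subset of `ℝ^σ` contains one, `exists_algebraicIndependent_mem_of_isOpen`).
* **§3 Thm. 2, Baire form, at torus level.**  For every integral `j` with `j² = −1`, `ᵗj = −j` (`g ≥ 1`)
  the set of parameters `v = (A, B) ∈ ℝ^{2g²}` for which the torus `X_Z`, `Z = Z(A + ᵗA, ᵗBB + 1) ∈ 𝔜_j`,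
  satisfies: `(X_Z, E_Z) ≅ (X_{−Z̄}, E_{−Z̄})` as principally polarized tori, `End(X_Z) = ℤ`, and
  `IsEmpty (RealStructure X_Z)` — contains the algebraically independent ones (g49-#1), hence is residual
  and dense in `ℝ^{2g²}` (`setOf_sweepPoint_generic_mem_residual`, `dense_setOf_sweepPoint_generic`): every
  non-empty open set of parameters contains such a point (`exists_sweepPoint_generic_mem_of_isOpen`).
-/

noncomputable section

open scoped Manifold Matrix ComplexConjugate Topology
open Matrix Complex Function Set Filter

namespace Literature.AlgebraicGeometry.ModuliOfAbelianVarieties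

namespace SiegelModuli

open Literature.NumberTheory.Automorphic (siegelUpperHalfSpace)
open Literature.Geometry.Kaehler Literature.Geometry.Kaehler.ComplexTorus

/-! ## §1 Prop. 11 in the parameter rendering: a real polynomial vanishing on a non-empty open set is `0` -/

section ZeroSets

variable {σ : Type*} [Fintype σ]

/-- **A real polynomial in finitely many variables vanishing on a non-empty open subset of `ℝ^σ` is `0`**
(«`X_f` … contains no non-empty open subset»; the open set contains a box `∏ (x_i − ε, x_i + ε)` with
infinite sides, on which `MvPolynomial.funext_set` applies). [cite: Shimura1972FieldOfRationality, §3 Prop. 11 (second assertion, (i)) and Thm. 2 proof («`X_f` … contains no non-empty open subset of `𝔜`»), pp. 175–177] -/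
theorem mvPolynomial_eq_zero_of_eval_eq_zero_of_isOpen {p : MvPolynomial σ ℝ} {U : Set (σ → ℝ)}
    (hU : IsOpen U) (hne : U.Nonempty) (h : ∀ x ∈ U, MvPolynomial.eval x p = 0) : p = 0 := by
  obtain ⟨x₀, hx₀⟩ := hne
  obtain ⟨ε, hε, hball⟩ := Metric.isOpen_iff.1 hU x₀ hx₀
  rw [ball_pi x₀ hε] at hball
  refine MvPolynomial.funext_set (fun i ↦ Metric.ball (x₀ i) ε) (fun i ↦ ?_) fun x hx ↦ ?_
  · rw [Real.ball_eq_Ioo]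
    exact Set.Ioo_infinite (by linarith)
  · rw [map_zero]
    exact h x (hball hx)

omit [Fintype σ] in
/-- The non-vanishing set `{x : p(x) ≠ 0}` of a real polynomial is open. [cite: Shimura1972FieldOfRationality, §3 Thm. 2 proof («`X_f` is a closed subset»), p. 177] -/
theorem isOpen_setOf_eval_ne_zero (p : MvPolynomial σ ℝ) : IsOpen {x : σ → ℝ | MvPolynomial.eval x p ≠ 0} :=
  isOpen_ne_fun (MvPolynomial.continuous_eval p) continuous_const

/-- **For `p ≠ 0` the non-vanishing set `{x : p(x) ≠ 0}` is dense** (the zero set `X_p` is closed with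
empty interior). [cite: Shimura1972FieldOfRationality, §3 Thm. 2 proof («`X_f` is a closed subset of `𝔜`, which contains no non-empty open subset»), p. 177] -/
theorem dense_setOf_eval_ne_zero {p : MvPolynomial σ ℝ} (hp : p ≠ 0) :
    Dense {x : σ → ℝ | MvPolynomial.eval x p ≠ 0} := by
  have hc : {x : σ → ℝ | MvPolynomial.eval x p ≠ 0} = {x : σ → ℝ | MvPolynomial.eval x p = 0}ᶜ := by
    ext x
    simp
  rw [hc, ← interior_eq_empty_iff_dense_compl]
  by_contra hne
  have hU : (interior {x : σ → ℝ | MvPolynomial.eval x p = 0}).Nonempty := Set.nonempty_iff_ne_empty.2 hne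
  exact hp (mvPolynomial_eq_zero_of_eval_eq_zero_of_isOpen isOpen_interior hU fun x hx ↦ by
    have hx' := interior_subset hx
    exact hx')

/-- The same for rational coefficients: for `p ∈ ℚ[x_σ]`, `p ≠ 0`, the set `{v : aeval v p ≠ 0} ⊆ ℝ^σ` is
open and dense. [cite: Shimura1972FieldOfRationality, §3 Thm. 2 proof (the `f ∈ S′` have rational coefficients), p. 177] -/
theorem isOpen_dense_setOf_aeval_ne_zero {p : MvPolynomial σ ℚ} (hp : p ≠ 0) :
    IsOpen {v : σ → ℝ | MvPolynomial.aeval v p ≠ 0} ∧ Dense {v : σ → ℝ | MvPolynomial.aeval v p ≠ 0} := by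
  have hset : {v : σ → ℝ | MvPolynomial.aeval v p ≠ 0} =
      {v : σ → ℝ | MvPolynomial.eval v (MvPolynomial.map (algebraMap ℚ ℝ) p) ≠ 0} := by
    ext v
    rw [Set.mem_setOf_eq, Set.mem_setOf_eq, MvPolynomial.aeval_def, MvPolynomial.eval_map]
  have hp' : MvPolynomial.map (algebraMap ℚ ℝ) p ≠ 0 := fun h0 ↦
    hp (MvPolynomial.map_injective (algebraMap ℚ ℝ) (algebraMap ℚ ℝ).injective (by rw [h0, map_zero]))
  rw [hset]
  exact ⟨isOpen_setOf_eval_ne_zero _, dense_setOf_eval_ne_zero hp'⟩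

end ZeroSets

/-! ## §2 «Since `S′` is a countable set, `𝔜` cannot be covered by `∪_{f ∈ S′} X_f`»: the algebraically
independent parameters form a dense `G_δ`, residual set -/

section Baire

variable {σ : Type*}

/-- `ℚ[x_σ]` is countable for countably many variables («`S′` is a countable set»). [cite: Shimura1972FieldOfRationality, §3 Thm. 2 proof, p. 177] -/
theorem countable_mvPolynomial_rat [Countable σ] : Countable (MvPolynomial σ ℚ) := by
  rw [← Cardinal.mk_le_aleph0_iff]
  refine (MvPolynomial.cardinalMk_le_max_lift (σ := σ) (R := ℚ)).trans ?_
  rw [Cardinal.mkRat, Cardinal.lift_aleph0]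
  exact sup_le (sup_le le_rfl (Cardinal.lift_le_aleph0.2 Cardinal.mk_le_aleph0)) le_rfl

/-- **The algebraically independent parameters are the complement of the countable union of the zero sets
`X_p`, `p ≠ 0`**: `{v : AlgebraicIndependent ℚ v} = ⋂_{p ≠ 0} {v : aeval v p ≠ 0}`. [cite: Shimura1972FieldOfRationality, §3 Thm. 2 proof («a point `z` for which `f(φ(z)) ≠ 0` for all `f ∈ S′` … Then `φ(z)` is generic»), p. 177] -/
theorem setOf_algebraicIndependent_eq_biInter :
    {v : σ → ℝ | AlgebraicIndependent ℚ v} =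
      ⋂ p ∈ {p : MvPolynomial σ ℚ | p ≠ 0}, {v : σ → ℝ | MvPolynomial.aeval v p ≠ 0} := by
  ext v
  simp only [Set.mem_setOf_eq, Set.mem_iInter, algebraicIndependent_iff]
  exact forall_congr' fun p ↦ ⟨fun h hp h0 ↦ hp (h h0), fun h h0 ↦ by_contra fun hp ↦ h hp h0⟩

variable [Fintype σ]

/-- The algebraically independent parameters form a `G_δ`. [cite: Shimura1972FieldOfRationality, §3 Thm. 2 proof, p. 177] -/
theorem isGδ_setOf_algebraicIndependent : IsGδ {v : σ → ℝ | AlgebraicIndependent ℚ v} := by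
  haveI : Countable (MvPolynomial σ ℚ) := countable_mvPolynomial_rat
  rw [setOf_algebraicIndependent_eq_biInter]
  exact .biInter_of_isOpen (Set.to_countable _) fun p hp ↦ (isOpen_dense_setOf_aeval_ne_zero hp).1

/-- **Baire: the algebraically independent parameters are residual (comeagre) in `ℝ^σ`** — a countable
intersection of open dense sets. [cite: Shimura1972FieldOfRationality, §3 Thm. 2 proof («Since `S′` is a countable set, `𝔜` cannot be covered by `∪_{f ∈ S′} X_f`»), p. 177] -/
theorem setOf_algebraicIndependent_mem_residual : {v : σ → ℝ | AlgebraicIndependent ℚ v} ∈ residual (σ → ℝ) := by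
  haveI : Countable (MvPolynomial σ ℚ) := countable_mvPolynomial_rat
  rw [setOf_algebraicIndependent_eq_biInter, countable_bInter_mem (Set.to_countable _)]
  exact fun p hp ↦ residual_of_dense_open (isOpen_dense_setOf_aeval_ne_zero hp).1
    (isOpen_dense_setOf_aeval_ne_zero hp).2

/-- **The algebraically independent parameters are dense in `ℝ^σ`.** [cite: Shimura1972FieldOfRationality, §3 Thm. 2 proof («`𝔜` cannot be covered by `∪_{f ∈ S′} X_f`»), p. 177] -/
theorem dense_setOf_algebraicIndependent : Dense {v : σ → ℝ | AlgebraicIndependent ℚ v} :=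
  dense_of_mem_residual setOf_algebraicIndependent_mem_residual

/-- Every non-empty open subset of `ℝ^σ` contains an algebraically independent point («Therefore `𝔜` has
a point `z` for which `f(φ(z)) ≠ 0` for all `f ∈ S′`»). [cite: Shimura1972FieldOfRationality, §3 Thm. 2 proof, p. 177] -/
theorem exists_algebraicIndependent_mem_of_isOpen {U : Set (σ → ℝ)} (hU : IsOpen U) (hne : U.Nonempty) :
    ∃ v ∈ U, AlgebraicIndependent ℚ v := by
  obtain ⟨v, hvU, hv⟩ := dense_setOf_algebraicIndependent.inter_open_nonempty U hU hne
  exact ⟨v, hvU, hv⟩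

end Baire

/-! ## §3 Thm. 2, Baire form, at torus level: for every `j`, the parameters of the sweep of `𝔜_j` whose
torus has `End(X_Z) = ℤ`, `(X_Z, E_Z) ≅ (X_{−Z̄}, E_{−Z̄})` and no real structure are residual and dense -/

section Torus

variable {g : ℕ} (hδ : ∀ i, 0 < (1 : Fin g → ℕ) i) {j : Matrix (Fin g) (Fin g) ℤ}

/-- The generic parameters contain the algebraically independent ones (g49-#1 at each such `v`).
[cite: Shimura1972FieldOfRationality, §3 Thm. 2 and its proof, pp. 176–177] -/
theorem setOf_algebraicIndependent_subset_sweepPoint_generic (hg : 0 < g) (hjj : j * j = -1) (hjT : jᵀ = -j) :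
    {v : Fin 2 × Fin g × Fin g → ℝ | AlgebraicIndependent ℚ v} ⊆
    {v : Fin 2 × Fin g × Fin g → ℝ |
      (∃ h : ComplexTorus (siegelPeriodEquiv hδ (sweepPoint_mem_siegelUpperHalfSpace j v hjT rfl)) ≃+
          ComplexTorus (siegelPeriodEquiv hδ (neg_map_conj_mem_siegelUpperHalfSpace
            (sweepPoint_mem_siegelUpperHalfSpace j v hjT rfl))),
        IsPolarizedIso (siegelPeriodEquiv hδ (sweepPoint_mem_siegelUpperHalfSpace j v hjT rfl))
          (siegelForm hδ (sweepPoint_mem_siegelUpperHalfSpace j v hjT rfl))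
          (siegelPeriodEquiv hδ (neg_map_conj_mem_siegelUpperHalfSpace
            (sweepPoint_mem_siegelUpperHalfSpace j v hjT rfl)))
          (siegelForm hδ (neg_map_conj_mem_siegelUpperHalfSpace
            (sweepPoint_mem_siegelUpperHalfSpace j v hjT rfl))) h) ∧
      (∀ M : Matrix (Fin g ⊕ Fin g) (Fin g ⊕ Fin g) ℤ,
        (∀ x, (M.map (Int.cast : ℤ → ℝ)) *ᵥ
            latticeJ (siegelPeriodEquiv hδ (sweepPoint_mem_siegelUpperHalfSpace j v hjT rfl)) x =
          latticeJ (siegelPeriodEquiv hδ (sweepPoint_mem_siegelUpperHalfSpace j v hjT rfl))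
            ((M.map (Int.cast : ℤ → ℝ)) *ᵥ x)) → ∃ c : ℤ, M = c • 1) ∧
      IsEmpty (RealStructure 𝓘(ℂ, Fin g → ℂ)
        (ComplexTorus (siegelPeriodEquiv hδ (sweepPoint_mem_siegelUpperHalfSpace j v hjT rfl))))} := by
  intro v hv
  obtain ⟨hpol, -, hend, hempty⟩ :=
    sweepPoint_isPolarizedIso_conj_and_isEmpty_realStructure_of_locusJ hδ
      (sweepPoint_mem_siegelUpperHalfSpace j v hjT rfl) hg hjj hjT hv rfl
  exact ⟨hpol, hend, hempty⟩

/-- **Thm. 2, Baire form, at torus level: the generic parameters are residual.**  For every integral `j`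
with `j² = −1`, `ᵗj = −j` (`g ≥ 1`), the set of `v = (A, B) ∈ ℝ^{2g²}` for which the principally
polarized torus `(X_Z, E_Z)`, `Z = Z(A + ᵗA, ᵗBB + 1) ∈ 𝔜_j`, is isomorphic to its conjugate
`(X_{−Z̄}, E_{−Z̄})`, has `End(X_Z) = ℤ`, and admits NO real structure, is residual (comeagre) in
`ℝ^{2g²}` («Since `S′` is a countable set, `𝔜` cannot be covered by `∪_{f ∈ S′} X_f`»).
[cite: Shimura1972FieldOfRationality, §3 Thm. 2 and its proof, pp. 176–177] -/
theorem setOf_sweepPoint_generic_mem_residual (hg : 0 < g) (hjj : j * j = -1) (hjT : jᵀ = -j) :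
    {v : Fin 2 × Fin g × Fin g → ℝ |
      (∃ h : ComplexTorus (siegelPeriodEquiv hδ (sweepPoint_mem_siegelUpperHalfSpace j v hjT rfl)) ≃+
          ComplexTorus (siegelPeriodEquiv hδ (neg_map_conj_mem_siegelUpperHalfSpace
            (sweepPoint_mem_siegelUpperHalfSpace j v hjT rfl))),
        IsPolarizedIso (siegelPeriodEquiv hδ (sweepPoint_mem_siegelUpperHalfSpace j v hjT rfl))
          (siegelForm hδ (sweepPoint_mem_siegelUpperHalfSpace j v hjT rfl))
          (siegelPeriodEquiv hδ (neg_map_conj_mem_siegelUpperHalfSpace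
            (sweepPoint_mem_siegelUpperHalfSpace j v hjT rfl)))
          (siegelForm hδ (neg_map_conj_mem_siegelUpperHalfSpace
            (sweepPoint_mem_siegelUpperHalfSpace j v hjT rfl))) h) ∧
      (∀ M : Matrix (Fin g ⊕ Fin g) (Fin g ⊕ Fin g) ℤ,
        (∀ x, (M.map (Int.cast : ℤ → ℝ)) *ᵥ
            latticeJ (siegelPeriodEquiv hδ (sweepPoint_mem_siegelUpperHalfSpace j v hjT rfl)) x =
          latticeJ (siegelPeriodEquiv hδ (sweepPoint_mem_siegelUpperHalfSpace j v hjT rfl))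
            ((M.map (Int.cast : ℤ → ℝ)) *ᵥ x)) → ∃ c : ℤ, M = c • 1) ∧
      IsEmpty (RealStructure 𝓘(ℂ, Fin g → ℂ)
        (ComplexTorus (siegelPeriodEquiv hδ (sweepPoint_mem_siegelUpperHalfSpace j v hjT rfl))))} ∈
      residual (Fin 2 × Fin g × Fin g → ℝ) :=
  Filter.mem_of_superset setOf_algebraicIndependent_mem_residual
    (setOf_algebraicIndependent_subset_sweepPoint_generic hδ hg hjj hjT)

/-- **Thm. 2, Baire form, at torus level: the generic parameters are dense in `ℝ^{2g²}`.**
[cite: Shimura1972FieldOfRationality, §3 Thm. 2 and its proof («`𝔜` cannot be covered by `∪_{f ∈ S′} X_f`»), pp. 176–177] -/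
theorem dense_setOf_sweepPoint_generic (hg : 0 < g) (hjj : j * j = -1) (hjT : jᵀ = -j) :
    Dense {v : Fin 2 × Fin g × Fin g → ℝ |
      (∃ h : ComplexTorus (siegelPeriodEquiv hδ (sweepPoint_mem_siegelUpperHalfSpace j v hjT rfl)) ≃+
          ComplexTorus (siegelPeriodEquiv hδ (neg_map_conj_mem_siegelUpperHalfSpace
            (sweepPoint_mem_siegelUpperHalfSpace j v hjT rfl))),
        IsPolarizedIso (siegelPeriodEquiv hδ (sweepPoint_mem_siegelUpperHalfSpace j v hjT rfl))
          (siegelForm hδ (sweepPoint_mem_siegelUpperHalfSpace j v hjT rfl))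
          (siegelPeriodEquiv hδ (neg_map_conj_mem_siegelUpperHalfSpace
            (sweepPoint_mem_siegelUpperHalfSpace j v hjT rfl)))
          (siegelForm hδ (neg_map_conj_mem_siegelUpperHalfSpace
            (sweepPoint_mem_siegelUpperHalfSpace j v hjT rfl))) h) ∧
      (∀ M : Matrix (Fin g ⊕ Fin g) (Fin g ⊕ Fin g) ℤ,
        (∀ x, (M.map (Int.cast : ℤ → ℝ)) *ᵥ
            latticeJ (siegelPeriodEquiv hδ (sweepPoint_mem_siegelUpperHalfSpace j v hjT rfl)) x =
          latticeJ (siegelPeriodEquiv hδ (sweepPoint_mem_siegelUpperHalfSpace j v hjT rfl))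
            ((M.map (Int.cast : ℤ → ℝ)) *ᵥ x)) → ∃ c : ℤ, M = c • 1) ∧
      IsEmpty (RealStructure 𝓘(ℂ, Fin g → ℂ)
        (ComplexTorus (siegelPeriodEquiv hδ (sweepPoint_mem_siegelUpperHalfSpace j v hjT rfl))))} :=
  dense_of_mem_residual (setOf_sweepPoint_generic_mem_residual hδ hg hjj hjT)

/-- **Every non-empty open set of parameters contains a generic point** («Therefore `𝔜` has a point `z` for
which `f(φ(z)) ≠ 0` for all `f ∈ S′`»): for `U ⊆ ℝ^{2g²}` open non-empty there is `v = (A, B) ∈ U` whose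
point `Z = Z(A + ᵗA, ᵗBB + 1)` lies in `𝔥_g ∩ 𝔜_j` and whose torus has `End(X_Z) = ℤ`, is isomorphic to its
conjugate as a principally polarized torus, and has no real structure.
[cite: Shimura1972FieldOfRationality, §3 Thm. 2 and its proof, pp. 176–177] -/
theorem exists_sweepPoint_generic_mem_of_isOpen (hg : 0 < g) (hjj : j * j = -1) (hjT : jᵀ = -j)
    {U : Set (Fin 2 × Fin g × Fin g → ℝ)} (hU : IsOpen U) (hne : U.Nonempty) :
    ∃ v ∈ U, ∃ (Z : Matrix (Fin g) (Fin g) ℂ) (hZ : Z ∈ siegelUpperHalfSpace g),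
      Z = (Matrix.of fun i k ↦ ((v (0, i, k) : ℝ) : ℂ)) + ((Matrix.of fun i k ↦ ((v (0, i, k) : ℝ) : ℂ)))ᵀ + j.map (Int.cast : ℤ → ℂ) * ((Matrix.of fun i k ↦ ((v (0, i, k) : ℝ) : ℂ)) + ((Matrix.of fun i k ↦ ((v (0, i, k) : ℝ) : ℂ)))ᵀ) * j.map (Int.cast : ℤ → ℂ) +
        Complex.I • (((Matrix.of fun i k ↦ ((v (1, i, k) : ℝ) : ℂ)))ᵀ * (Matrix.of fun i k ↦ ((v (1, i, k) : ℝ) : ℂ)) + 1 - j.map (Int.cast : ℤ → ℂ) * (((Matrix.of fun i k ↦ ((v (1, i, k) : ℝ) : ℂ)))ᵀ * (Matrix.of fun i k ↦ ((v (1, i, k) : ℝ) : ℂ)) + 1) * j.map (Int.cast : ℤ → ℂ)) ∧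
      j.map (Int.cast : ℤ → ℂ) * Z = -Z.map conj * j.map (Int.cast : ℤ → ℂ) ∧
      (∃ h : ComplexTorus (siegelPeriodEquiv hδ hZ) ≃+
          ComplexTorus (siegelPeriodEquiv hδ (neg_map_conj_mem_siegelUpperHalfSpace hZ)),
        IsPolarizedIso (siegelPeriodEquiv hδ hZ) (siegelForm hδ hZ)
          (siegelPeriodEquiv hδ (neg_map_conj_mem_siegelUpperHalfSpace hZ))
          (siegelForm hδ (neg_map_conj_mem_siegelUpperHalfSpace hZ)) h) ∧
      (∀ M : Matrix (Fin g ⊕ Fin g) (Fin g ⊕ Fin g) ℤ,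
          (∀ x, (M.map (Int.cast : ℤ → ℝ)) *ᵥ latticeJ (siegelPeriodEquiv hδ hZ) x =
            latticeJ (siegelPeriodEquiv hδ hZ) ((M.map (Int.cast : ℤ → ℝ)) *ᵥ x)) → ∃ c : ℤ, M = c • 1) ∧
      IsEmpty (RealStructure 𝓘(ℂ, Fin g → ℂ) (ComplexTorus (siegelPeriodEquiv hδ hZ))) := by
  obtain ⟨v, hvU, hv⟩ := exists_algebraicIndependent_mem_of_isOpen hU hne
  have hZ𝔥 := sweepPoint_mem_siegelUpperHalfSpace j v hjT rfl
  obtain ⟨hpol, -, hend, hempty⟩ :=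
    sweepPoint_isPolarizedIso_conj_and_isEmpty_realStructure_of_locusJ hδ hZ𝔥 hg hjj hjT hv rfl
  exact ⟨v, hvU, _, hZ𝔥, rfl, sweepPoint_rel j v hjj rfl, hpol, hend, hempty⟩

end Torus

end SiegelModuli

end Literature.AlgebraicGeometry.ModuliOfAbelianVarieties
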